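import Summits.Parity.BatemanHorn.Theorems.SoloInformedRootPairFamilies
import Summits.Parity.BatemanHorn.Theorems.SoloInformedHooleyMeanProfile
import Literature.Barriers.ABC.BakerMethodBounds

/-!
# The ceiling of class-wise methods: cancellation ACROSS classes of moduli is necessary

Informed soloist `solo-Parity-informed` (session 145), conjunct `BatemanHorn`, the `d ≥ 3` rung BELOW the parity
wall (`ErdosDivisorSumAsymptotic g`, `g` an irreducible cubic ⟸ the `ℓ¹` profile `HooleyMeanProfile g θ η`,
`θ > 2/3`, `η > 1/3`, of the sums `T(h) = ∑_{E<e≤E'} S_g(h;e)`; second-moment currency `HooleyMeanSquareLocal`).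
`SoloInformedIntraModulusCeiling` recorded the ceiling of bounds with the absolute values INSIDE the sum over the
moduli (the partition of `(E, E']` into singletons).  This file proves the same Fejér-positivity ceiling for an
ARBITRARY finite family `S` of moduli and an ARBITRARY partition of it into classes `S_a = {e ∈ S : c(e) = a}`
(`c` any labelling: the largest prime factor, the value of a chosen divisor, a residue class, …), with
`U_a(h) = ∑_{e ∈ S_a} S_g(h;e)`, `N_a = ∑_{e∈S_a} ρ_g(e)`, `N = ∑_{e∈S} ρ_g(e)`:

* (companion file `SoloInformedRootPairFamilies`: the Fejér identity and sandwich for any `S` — `rootPointsOn`,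
  `rootPairSumOn`, `mul_rootPairSumOn_eq`, `card_mul_sub_card_le_sum_Icc_norm_sq_on`: `N·(H − N) ≤
  ∑_{1≤h≤H}(‖U_S(h)‖² + ‖U_S(−h)‖²)`, and `sub_card_le_sum_Icc_norm_on`: `H − N ≤ ∑_{1≤h≤H}(‖U_S(h)‖ + ‖U_S(−h)‖)`
  when `N ≥ 1`);
* **the `ℓ¹` class ceiling** (`card_mul_sub_card_le_sum_sum_norm_classes`):
  `H·#{a : N_a ≥ 1} − N ≤ ∑_{1≤h≤H} ∑_a (‖U_a(h)‖ + ‖U_a(−h)‖)`,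
  the bounded-class form (`sub_mul_card_le_sum_sum_norm_classes`): `(H − M)·#{a : 1 ≤ N_a ≤ M} ≤ ∑_{1≤h≤H} ∑_a
  (‖U_a(h)‖ + ‖U_a(−h)‖)`, and its witness form (`sub_mul_card_le_sum_sum_norm_classes_of_separated`): if the
  labelling separates a set `P` of witnesses `w(p) ∈ S` with `ρ_g(w(p)) ≥ 1` (`p ≠ p' ⇒ c(w p) ≠ c(w p')`) whose
  classes have `≤ M` root points, then `(H − M)·#P ≤ ∑_{1≤h≤H} ∑_a (‖U_a(h)‖ + ‖U_a(−h)‖)`; hence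
  (`card_separated_le_of_classwise_le`) a class-wise bound `≤ B` at a scale `H ≥ 2M` forces `#P ≤ 2B/H`; the instance
  `c = P⁺` (largest prime factor), `w(p) = q₀·p` is `sub_mul_card_le_sum_sum_norm_largestPrimeFactor`;
* **the `ℓ²` (dispersion) class ceiling** (`sub_mul_card_le_sum_sum_norm_sq_classes`): if every class has
  `N_a ≤ M` then `(H − M)·N ≤ ∑_{1≤h≤H} ∑_a (‖U_a(h)‖² + ‖U_a(−h)‖²)`, while the first step of a dispersion
  argument is `‖U_S(h)‖² ≤ #{classes}·∑_a ‖U_a(h)‖²` (`norm_sq_sum_hooleySum_le_card_mul_sum_classes`); hence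
  (`card_rootPointsOn_le_of_classwise_sq_le`) a bound `∑_{1≤h≤H}∑_a(‖U_a(h)‖² + ‖U_a(−h)‖²) ≤ B` at a scale `H ≥ 2M`
  forces `N ≤ 2B/H`;
* in the profile currency: the CLASS-WISE profile `ClasswiseMeanProfile g c θ η` (the bound of `HooleyMeanProfile`
  for the class-wise majorant) implies `HooleyMeanProfile g θ η` (`ClasswiseMeanProfile.hooleyMeanProfile`: every
  labelling is a legitimate route), and forces `(H − M)·#P ≤ ε·E + C·H·E^{1−η}` for every witness set of the range
  separated into classes of `≤ M` root points (`ClasswiseMeanProfile.sub_mul_card_separated_le`).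

Reading (prose; SHARPEST-STATEMENT §4.A of the line).  (1) Take `S` = the moduli of `(E, 2E]` (or only the composite
ones), `c(e) = P⁺(e)` the largest prime factor, `w(p) = q₀·p` for the least prime `q₀` at which `g` has a root and
`p ∈ (E/q₀, 2E/q₀]` a prime `≠ q₀` with a root (`ρ_g(q₀p) = ρ_g(q₀)ρ_g(p) ≥ 1`,
`Literature.NumberTheory.Sieve.polyRootCountMod_mul_of_coprime`): `#P ≫_g E/log E` (Chebotarev–Frobenius), so a
class-wise `ℓ¹` bound with the cofactor of the largest prime summed INSIDE the absolute value and the largest prime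
OUTSIDE — every "cofactor-active, largest-prime-passive" argument, Hooley's shape `e = ab` included — gives the
profile's `ε`-part only for `H ≲ ε·log E`, exactly the singleton ceiling: the largest prime factor of the modulus must
be an ACTIVE (cancelling) variable, i.e. the rung needs cancellation in sums over PRIMES `p` of the root data
`S_g(h δ̄; p)`.  (2) More generally no labelling with more than `(ε·E^{1−θ} + C·E^{1−η} + N·E^{−θ})` rooted classes
— fewer than `E^{1/3}` at the cubic thresholds — can carry absolute values.  (3) In the second-moment currency
(`HooleyMeanSquareLocal g θ η`: `∑_{1≤|h|≤H} ‖T(h)‖² ≤ C·H·E^{2(1−η)}`), a dispersion argument that applies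
Cauchy–Schwarz over `J` classes and then bounds `∑_a ‖U_a(h)‖²` can certify at best `C·H·E^{2(1−η)} ≥ J·(H − M)·N`,
i.e. `J ≤ 2C·E^{2(1−η)}/N ≍ E^{1−2η}`: for `η > 1/3` the OUTER variable of the dispersion ranges over fewer than
`E^{1/3}` classes and the dispersed variable over blocks of more than `E^{2/3}` moduli.  Nothing here touches a
parity-blocked statement; the file only constrains the SHAPE of a proof of the open rung.
-/

namespace Summit.Parity.BatemanHorn.Theorems

open Finset Polynomial Literature.NumberTheory.Sieve
open Literature.Barriers.ABC (largestPrimeFactor largestPrimeFactor_def)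

variable {α : Type*} [DecidableEq α]

/-! ### The `ℓ¹` class ceiling -/

/-- **The `ℓ¹` ceiling of class-wise methods.**  For every finite family `S` of moduli, every labelling `c` and
every `H`: `H·#{a : N_a ≥ 1} − N ≤ ∑_{1≤h≤H} ∑_a (‖U_a(h)‖ + ‖U_a(−h)‖)`. [this work] -/
theorem card_mul_sub_card_le_sum_sum_norm_classes (g : ℤ[X]) (S : Finset ℕ) (c : ℕ → α) (H : ℕ) :
    (H : ℝ) * #{a ∈ S.image c | 1 ≤ #(rootPointsOn g {e ∈ S | c e = a})} - #(rootPointsOn g S) ≤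
      ∑ h ∈ Icc 1 H, ∑ a ∈ S.image c,
        (‖∑ e ∈ S with c e = a, hooleySum g e h‖ + ‖∑ e ∈ S with c e = a, hooleySum g e (-(h : ℤ))‖) := by
  rw [sum_comm]
  set A := S.image c with hA
  set R := {a ∈ A | 1 ≤ #(rootPointsOn g {e ∈ S | c e = a})} with hR
  have hRA : R ⊆ A := filter_subset _ _
  -- the rooted classes
  have h1 : (H : ℝ) * #R - ∑ a ∈ R, (#(rootPointsOn g {e ∈ S | c e = a}) : ℝ) ≤
      ∑ a ∈ R, ∑ h ∈ Icc 1 H,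
        (‖∑ e ∈ S with c e = a, hooleySum g e h‖ + ‖∑ e ∈ S with c e = a, hooleySum g e (-(h : ℤ))‖) := by
    have : (H : ℝ) * #R - ∑ a ∈ R, (#(rootPointsOn g {e ∈ S | c e = a}) : ℝ) =
        ∑ a ∈ R, ((H : ℝ) - #(rootPointsOn g {e ∈ S | c e = a})) := by
      rw [sum_sub_distrib, sum_const, nsmul_eq_mul, mul_comm]
    rw [this]
    exact sum_le_sum fun a ha => sub_card_le_sum_Icc_norm_on g (mem_filter.1 ha).2 H
  have h2 : ∑ a ∈ R, (#(rootPointsOn g {e ∈ S | c e = a}) : ℝ) ≤ #(rootPointsOn g S) := by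
    calc ∑ a ∈ R, (#(rootPointsOn g {e ∈ S | c e = a}) : ℝ)
        ≤ ∑ a ∈ A, (#(rootPointsOn g {e ∈ S | c e = a}) : ℝ) :=
          sum_le_sum_of_subset_of_nonneg hRA fun _ _ _ => Nat.cast_nonneg _
      _ = #(rootPointsOn g S) := by rw [hA]; exact_mod_cast sum_card_rootPointsOn_classes g S c
  have h3 : ∑ a ∈ R, ∑ h ∈ Icc 1 H,
        (‖∑ e ∈ S with c e = a, hooleySum g e h‖ + ‖∑ e ∈ S with c e = a, hooleySum g e (-(h : ℤ))‖) ≤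
      ∑ a ∈ A, ∑ h ∈ Icc 1 H,
        (‖∑ e ∈ S with c e = a, hooleySum g e h‖ + ‖∑ e ∈ S with c e = a, hooleySum g e (-(h : ℤ))‖) :=
    sum_le_sum_of_subset_of_nonneg hRA fun _ _ _ => sum_nonneg fun _ _ => by positivity
  linarith

/-- **The `ℓ¹` ceiling, bounded classes** (the analogue of `sub_mul_card_le_sum_sum_norm_hooleySum`, which is the
partition into singletons with `M = R`): `(H − M)·#{a : 1 ≤ N_a ≤ M} ≤ ∑_{1≤h≤H} ∑_a (‖U_a(h)‖ + ‖U_a(−h)‖)`. [this work] -/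
theorem sub_mul_card_le_sum_sum_norm_classes (g : ℤ[X]) (S : Finset ℕ) (c : ℕ → α) (H M : ℕ) :
    ((H : ℝ) - M) *
        #{a ∈ S.image c | 1 ≤ #(rootPointsOn g {e ∈ S | c e = a}) ∧ #(rootPointsOn g {e ∈ S | c e = a}) ≤ M} ≤
      ∑ h ∈ Icc 1 H, ∑ a ∈ S.image c,
        (‖∑ e ∈ S with c e = a, hooleySum g e h‖ + ‖∑ e ∈ S with c e = a, hooleySum g e (-(h : ℤ))‖) := by
  rw [sum_comm]
  set R := {a ∈ S.image c | 1 ≤ #(rootPointsOn g {e ∈ S | c e = a}) ∧ #(rootPointsOn g {e ∈ S | c e = a}) ≤ M}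
    with hR
  calc ((H : ℝ) - M) * #R = ∑ a ∈ R, ((H : ℝ) - M) := by rw [sum_const, nsmul_eq_mul, mul_comm]
    _ ≤ ∑ a ∈ R, ∑ h ∈ Icc 1 H,
          (‖∑ e ∈ S with c e = a, hooleySum g e h‖ + ‖∑ e ∈ S with c e = a, hooleySum g e (-(h : ℤ))‖) := by
        refine sum_le_sum fun a ha => ?_
        obtain ⟨_, h1, hM⟩ := mem_filter.1 ha
        have hM' : (#(rootPointsOn g {e ∈ S | c e = a}) : ℝ) ≤ M := by exact_mod_cast hM
        calc (H : ℝ) - M ≤ (H : ℝ) - #(rootPointsOn g {e ∈ S | c e = a}) := by linarith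
          _ ≤ _ := sub_card_le_sum_Icc_norm_on g h1 H
    _ ≤ _ := sum_le_sum_of_subset_of_nonneg (filter_subset _ _) fun _ _ _ => sum_nonneg fun _ _ => by positivity

/-- **Witness form.**  If the labelling separates a finite set `P` of witnesses — `w(p) ∈ S` has a root of `g` for
`p ∈ P`, `c ∘ w` is injective on `P` — and the class of each witness has at most `M` root points, then
`(H − M)·#P ≤ ∑_{1≤h≤H} ∑_a (‖U_a(h)‖ + ‖U_a(−h)‖)`. [this work] -/
theorem sub_mul_card_le_sum_sum_norm_classes_of_separated (g : ℤ[X]) (S : Finset ℕ) (c : ℕ → α) (H : ℕ)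
    {M : ℕ} {P : Finset ℕ} {w : ℕ → ℕ} (hwS : ∀ p ∈ P, w p ∈ S) (hwr : ∀ p ∈ P, 1 ≤ polyRootCountMod ![g] (w p))
    (hinj : Set.InjOn (fun p => c (w p)) P) (hM : ∀ p ∈ P, #(rootPointsOn g {e ∈ S | c e = c (w p)}) ≤ M) :
    ((H : ℝ) - M) * #P ≤
      ∑ h ∈ Icc 1 H, ∑ a ∈ S.image c,
        (‖∑ e ∈ S with c e = a, hooleySum g e h‖ + ‖∑ e ∈ S with c e = a, hooleySum g e (-(h : ℤ))‖) := by
  have hsub : P.image (fun p => c (w p)) ⊆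
      {a ∈ S.image c | 1 ≤ #(rootPointsOn g {e ∈ S | c e = a}) ∧ #(rootPointsOn g {e ∈ S | c e = a}) ≤ M} := by
    intro a ha
    obtain ⟨p, hp, rfl⟩ := mem_image.1 ha
    refine mem_filter.2 ⟨mem_image_of_mem c (hwS p hp), ?_, hM p hp⟩
    have hmem : w p ∈ {e ∈ S | c e = c (w p)} := mem_filter.2 ⟨hwS p hp, rfl⟩
    calc 1 ≤ polyRootCountMod ![g] (w p) := hwr p hp
      _ = #(rootPointsOn g {w p}) := by rw [card_rootPointsOn, sum_singleton]
      _ ≤ #(rootPointsOn g {e ∈ S | c e = c (w p)}) := card_rootPointsOn_mono g (singleton_subset_iff.2 hmem)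
  have hcard : (#P : ℝ) ≤
      #{a ∈ S.image c | 1 ≤ #(rootPointsOn g {e ∈ S | c e = a}) ∧ #(rootPointsOn g {e ∈ S | c e = a}) ≤ M} := by
    rw [← card_image_of_injOn hinj]
    exact_mod_cast card_le_card hsub
  have key := sub_mul_card_le_sum_sum_norm_classes g S c H M
  rcases le_or_gt (M : ℝ) H with hMH | hMH
  · exact (mul_le_mul_of_nonneg_left hcard (sub_nonneg.2 hMH)).trans key
  · exact (mul_nonpos_of_nonpos_of_nonneg (sub_neg.2 hMH).le (Nat.cast_nonneg _)).trans
      (sum_nonneg fun _ _ => sum_nonneg fun _ _ => by positivity)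

/-- **Consequence.**  A class-wise `ℓ¹` bound `≤ B` at a scale `H ≥ 2M`, `H ≥ 1`, allows at most `2B/H` rooted
witnesses separated by the labelling into classes of at most `M` root points. [this work] -/
theorem card_separated_le_of_classwise_le (g : ℤ[X]) (S : Finset ℕ) (c : ℕ → α) {H M : ℕ} (hMH : 2 * M ≤ H)
    (hH : 1 ≤ H) {P : Finset ℕ} {w : ℕ → ℕ} (hwS : ∀ p ∈ P, w p ∈ S)
    (hwr : ∀ p ∈ P, 1 ≤ polyRootCountMod ![g] (w p)) (hinj : Set.InjOn (fun p => c (w p)) P)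
    (hM : ∀ p ∈ P, #(rootPointsOn g {e ∈ S | c e = c (w p)}) ≤ M) {B : ℝ}
    (hb : ∑ h ∈ Icc 1 H, ∑ a ∈ S.image c,
        (‖∑ e ∈ S with c e = a, hooleySum g e h‖ + ‖∑ e ∈ S with c e = a, hooleySum g e (-(h : ℤ))‖) ≤ B) :
    (#P : ℝ) ≤ 2 * B / H := by
  have key := (sub_mul_card_le_sum_sum_norm_classes_of_separated g S c H hwS hwr hinj hM).trans hb
  have hHM : (H : ℝ) / 2 ≤ (H : ℝ) - M := by
    have : (2 * M : ℝ) ≤ H := by exact_mod_cast hMH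
    linarith
  have hHpos : (0 : ℝ) < H := by exact_mod_cast hH
  have h0 : (0 : ℝ) ≤ #P := Nat.cast_nonneg _
  have h2 : (H : ℝ) / 2 * #P ≤ B := (mul_le_mul_of_nonneg_right hHM h0).trans key
  rw [le_div_iff₀ hHpos]
  linarith

/-! ### Instance: the classes of the largest prime factor -/

/-- `P⁺(q·p) = p` for primes `q ≤ p` (`P⁺ = Literature.Barriers.ABC.largestPrimeFactor`, the tree's largest-prime-factor
function, `P⁺(0) = P⁺(1) = 1`). [folklore] -/
theorem largestPrimeFactor_prime_mul {q p : ℕ} (hq : q.Prime) (hp : p.Prime) (hqp : q ≤ p) :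
    largestPrimeFactor (q * p) = p := by
  have h : (q * p).primeFactors.sup id = p := by
    rw [Nat.primeFactors_mul hq.ne_zero hp.ne_zero, hq.primeFactors, hp.primeFactors, sup_union, sup_singleton,
      sup_singleton]
    exact sup_eq_right.2 hqp
  rw [largestPrimeFactor_def, h]
  exact max_eq_right hp.one_lt.le

/-- **Instance: the largest prime factor of the modulus cannot be a passive variable.**  Let `q₀` be a prime at
which `g` has a root, and `P` a finite set of primes `p > q₀` at which `g` has a root with `q₀·p ∈ S`, the class
`{e ∈ S : P⁺(e) = p}` of each having at most `M` root points.  Labelling the moduli of `S` by their largest prime factor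
(`U_p(h) = ∑_{e∈S, P⁺(e)=p} S_g(h;e)`: the cofactor `e/P⁺(e)` summed INSIDE the absolute value, with cancellation allowed,
the largest prime OUTSIDE): `(H − M)·#P ≤ ∑_{1≤h≤H} ∑_p (‖U_p(h)‖ + ‖U_p(−h)‖)`.  (For `S` = the composite moduli of
`(E, 2E]` and a prime `p ∈ (E/q₀, 2E/q₀]`, `p ≥ 2q₀`, not dividing the discriminant of `g`, the class of `p` is
`{δp : E/p < δ ≤ 2E/p}`, `δ < 2q₀`, with at most `M = deg g · ∑_{δ<2q₀} ρ_g(δ) = O_{g,q₀}(1)` root points, and `P` may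
be all such primes with a root of `g`: `≫_g E/log E` of them by Chebotarev–Frobenius — prose.) [this work] -/
theorem sub_mul_card_le_sum_sum_norm_largestPrimeFactor (g : ℤ[X]) (S : Finset ℕ) (H : ℕ) {q₀ M : ℕ}
    (hq₀ : q₀.Prime) (hr₀ : 1 ≤ polyRootCountMod ![g] q₀) {P : Finset ℕ}
    (hP : ∀ p ∈ P, p.Prime ∧ q₀ < p ∧ 1 ≤ polyRootCountMod ![g] p) (hPS : ∀ p ∈ P, q₀ * p ∈ S)
    (hM : ∀ p ∈ P, #(rootPointsOn g {e ∈ S | largestPrimeFactor e = p}) ≤ M) :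
    ((H : ℝ) - M) * #P ≤
      ∑ h ∈ Icc 1 H, ∑ a ∈ S.image largestPrimeFactor,
        (‖∑ e ∈ S with largestPrimeFactor e = a, hooleySum g e h‖ +
          ‖∑ e ∈ S with largestPrimeFactor e = a, hooleySum g e (-(h : ℤ))‖) := by
  have hc : ∀ p ∈ P, largestPrimeFactor (q₀ * p) = p := fun p hp =>
    largestPrimeFactor_prime_mul hq₀ (hP p hp).1 (hP p hp).2.1.le
  refine sub_mul_card_le_sum_sum_norm_classes_of_separated g S largestPrimeFactor H hPS (fun p hp => ?_)
    (fun p hp p' hp' heq => ?_) fun p hp => ?_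
  · obtain ⟨hp, hlt, hr⟩ := hP p hp
    rw [polyRootCountMod_mul_of_coprime g ((Nat.coprime_primes hq₀ hp).2 hlt.ne)]
    exact Nat.mul_le_mul hr₀ hr
  · simpa only [hc p hp, hc p' hp'] using heq
  · simpa only [hc p hp] using hM p hp

/-! ### The `ℓ²` (dispersion) class ceiling -/

/-- **The `ℓ²` ceiling of class-wise methods.**  If every class has at most `M` root points then
`(H − M)·N ≤ ∑_{1≤h≤H} ∑_a (‖U_a(h)‖² + ‖U_a(−h)‖²)`. [this work] -/
theorem sub_mul_card_le_sum_sum_norm_sq_classes (g : ℤ[X]) (S : Finset ℕ) (c : ℕ → α) (H : ℕ) {M : ℕ}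
    (hM : ∀ a ∈ S.image c, #(rootPointsOn g {e ∈ S | c e = a}) ≤ M) :
    ((H : ℝ) - M) * #(rootPointsOn g S) ≤
      ∑ h ∈ Icc 1 H, ∑ a ∈ S.image c,
        (‖∑ e ∈ S with c e = a, hooleySum g e h‖ ^ 2 + ‖∑ e ∈ S with c e = a, hooleySum g e (-(h : ℤ))‖ ^ 2) := by
  rw [sum_comm]
  have hN : (#(rootPointsOn g S) : ℝ) = ∑ a ∈ S.image c, (#(rootPointsOn g {e ∈ S | c e = a}) : ℝ) := by
    exact_mod_cast (sum_card_rootPointsOn_classes g S c).symm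
  rw [hN, mul_sum]
  refine sum_le_sum fun a ha => ?_
  have hMa : (#(rootPointsOn g {e ∈ S | c e = a}) : ℝ) ≤ M := by exact_mod_cast hM a ha
  have h0 : (0 : ℝ) ≤ #(rootPointsOn g {e ∈ S | c e = a}) := Nat.cast_nonneg _
  calc ((H : ℝ) - M) * #(rootPointsOn g {e ∈ S | c e = a})
      ≤ (#(rootPointsOn g {e ∈ S | c e = a}) : ℝ) * ((H : ℝ) - #(rootPointsOn g {e ∈ S | c e = a})) := by
        nlinarith
    _ ≤ _ := card_mul_sub_card_le_sum_Icc_norm_sq_on g {e ∈ S | c e = a} H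

/-- **Consequence.**  A class-wise second-moment bound `≤ B` at a scale `H ≥ 2M`, `H ≥ 1`, with classes of at most
`M` root points each, forces `N ≤ 2B/H`: a dispersion over `J` classes certifying the second-moment target
`C·H·E^{2(1−η)}` for `‖U_S‖²` has `J·H·N/2 ≤ C·H·E^{2(1−η)}`. [this work] -/
theorem card_rootPointsOn_le_of_classwise_sq_le (g : ℤ[X]) (S : Finset ℕ) (c : ℕ → α) {H M : ℕ}
    (hMH : 2 * M ≤ H) (hH : 1 ≤ H) (hM : ∀ a ∈ S.image c, #(rootPointsOn g {e ∈ S | c e = a}) ≤ M) {B : ℝ}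
    (hb : ∑ h ∈ Icc 1 H, ∑ a ∈ S.image c,
        (‖∑ e ∈ S with c e = a, hooleySum g e h‖ ^ 2 + ‖∑ e ∈ S with c e = a, hooleySum g e (-(h : ℤ))‖ ^ 2)
          ≤ B) :
    (#(rootPointsOn g S) : ℝ) ≤ 2 * B / H := by
  have key := (sub_mul_card_le_sum_sum_norm_sq_classes g S c H hM).trans hb
  have hHM : (H : ℝ) / 2 ≤ (H : ℝ) - M := by
    have : (2 * M : ℝ) ≤ H := by exact_mod_cast hMH
    linarith
  have hHpos : (0 : ℝ) < H := by exact_mod_cast hH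
  have h0 : (0 : ℝ) ≤ #(rootPointsOn g S) := Nat.cast_nonneg _
  have h2 : (H : ℝ) / 2 * #(rootPointsOn g S) ≤ B := (mul_le_mul_of_nonneg_right hHM h0).trans key
  rw [le_div_iff₀ hHpos]
  linarith

/-! ### In the profile currency -/

/-- **HYPOTHESIS (class-wise scale profile).**  The bound of `HooleyMeanProfile g θ η` for the class-wise majorant
`∑_a ‖U_a(±h)‖` of a labelling `c` of the moduli. [this work] -/
def ClasswiseMeanProfile (g : ℤ[X]) (c : ℕ → α) (θ η : ℝ) : Prop :=
  ∃ C : ℝ, ∀ ε : ℝ, 0 < ε → ∃ E₀ : ℕ, ∀ E E' H : ℕ, E₀ ≤ E → 1 ≤ E → E ≤ E' → E' ≤ 2 * E →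
    (H : ℝ) ≤ (E : ℝ) ^ θ →
    ∑ h ∈ Icc 1 H, ∑ a ∈ (Ioc E E').image c,
        (‖∑ e ∈ Ioc E E' with c e = a, hooleySum g e h‖ + ‖∑ e ∈ Ioc E E' with c e = a, hooleySum g e (-(h : ℤ))‖)
      ≤ ε * E + C * H * (E : ℝ) ^ (1 - η)

/-- Every class-wise profile gives the profile (triangle inequality over the classes). [this work] -/
theorem ClasswiseMeanProfile.hooleyMeanProfile {g : ℤ[X]} {c : ℕ → α} {θ η : ℝ}
    (hyp : ClasswiseMeanProfile g c θ η) : HooleyMeanProfile g θ η := by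
  obtain ⟨C, hC⟩ := hyp
  refine ⟨C, fun ε hε => ?_⟩
  obtain ⟨E₀, hE₀⟩ := hC ε hε
  refine ⟨E₀, fun E E' H h0 hE hEE' hE' hH => le_trans ?_ (hE₀ E E' H h0 hE hEE' hE' hH)⟩
  refine sum_le_sum fun h _ => ?_
  rw [sum_add_distrib]
  exact add_le_add (norm_sum_hooleySum_le_sum_classes g _ c h) (norm_sum_hooleySum_le_sum_classes g _ c _)

/-- **The ceiling in the profile currency.**  A class-wise profile gives, on every admissible range and scale
`H ≤ E^θ`, `(H − M)·#P ≤ ε·E + C·H·E^{1−η}` for every set `P` of rooted witnesses separated by the labelling into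
classes of at most `M` root points. [this work] -/
theorem ClasswiseMeanProfile.sub_mul_card_separated_le {g : ℤ[X]} {c : ℕ → α} {θ η : ℝ}
    (hyp : ClasswiseMeanProfile g c θ η) :
    ∃ C : ℝ, ∀ ε : ℝ, 0 < ε → ∃ E₀ : ℕ, ∀ E E' H : ℕ, E₀ ≤ E → 1 ≤ E → E ≤ E' → E' ≤ 2 * E →
      (H : ℝ) ≤ (E : ℝ) ^ θ → ∀ (M : ℕ) (P : Finset ℕ) (w : ℕ → ℕ), (∀ p ∈ P, w p ∈ Ioc E E') →
      (∀ p ∈ P, 1 ≤ polyRootCountMod ![g] (w p)) → Set.InjOn (fun p => c (w p)) P →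
      (∀ p ∈ P, #(rootPointsOn g {e ∈ Ioc E E' | c e = c (w p)}) ≤ M) →
      ((H : ℝ) - M) * #P ≤ ε * E + C * H * (E : ℝ) ^ (1 - η) := by
  obtain ⟨C, hC⟩ := hyp
  refine ⟨C, fun ε hε => ?_⟩
  obtain ⟨E₀, hE₀⟩ := hC ε hε
  exact ⟨E₀, fun E E' H h0 hE hEE' hE' hH M P w hwS hwr hinj hM =>
    (sub_mul_card_le_sum_sum_norm_classes_of_separated g (Ioc E E') c H hwS hwr hinj hM).trans
      (hE₀ E E' H h0 hE hEE' hE' hH)⟩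

end Summit.Parity.BatemanHorn.Theorems
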